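import Literature.NumberTheory.EllipticCurves.FineSelmerResidualCharacter
import Literature.NumberTheory.NumberFields.EquivariantUnramifiedDescentOpen
import Mathlib.Algebra.CharP.Lemmas
import Mathlib.NumberTheory.Padics.RingHoms
import HarnessLib

/-!
# The residual fine Selmer group read on `Gal(K̄/L_∞)`, II: a `Γ_K`-INVARIANT non-zero shadow
# (pro-`p` fixed point) — if `Sel₀(K_∞, M)` is infinite there is a non-zero `Γ_K`-equivariant
# everywhere-locally-trivial character of `Gal(K̄/L_∞)` (Coates–Sujatha 2005, proof of Thm. 3.4) — PROVED

Topic `NumberTheory/EllipticCurves` (namespace = path, grouping sub-namespace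
`FineSelmerResidualCharacter`).  THEOREM-ONLY file, sequel of `FineSelmerResidualCharacter.lean`
(notation as there), written by the literature seat `bsd-potss-conjA-anchor` g17 (cell `bsd-potss`;
serves the asides stmt-BirchSwinnertonDyer-19386 / 19413; closes nothing).

* `pow_sub_one_apply_eq_zero` — nilpotency: on an abelian group killed by the prime `p`, if a
  `ℤ`-linear endomorphism `A` satisfies `A^{p^k} v = v` then `(A - 1)^{p^k} v = 0`
  (`(A-1)^{p^k} = A^{p^k} - 1` in characteristic `p`, Mathlib `sub_pow_char_pow_of_commute`).
* `exists_invariant_shadow` — MAIN: `M` finite killed by `p`, `Λ₀ ⊴ Γ_K` open acting trivially on `M`,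
  `Sel₀(K_∞, M)` infinite ⟹ there is a non-zero shadow `f` (of a fine class) with
  `g • f(g⁻¹τg) = f(τ)` for ALL `g ∈ Γ_K`.  Proof (Coates, LNM 1716 Prop. 2.1, dual form: a pro-`p`
  group acting on a non-zero discrete `p`-torsion module has a non-zero fixed vector): a non-zero shadow
  `f₀` (part I) is fixed by an open normal `N₀` and by `ker κ`, hence by `γ^{p^e}` for a topological
  generator `γ` of `Γ_K / ker κ ≅ ℤ_p` (`pⁿℤ_p ⊆ κ(N₀)`, `EquivariantUnramifiedDescent.exists_level_totallyRamified`);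
  by nilpotency some `(γ-1)^j f₀` is non-zero and `γ`-fixed, hence fixed by `⟨γ⟩ · N · ker κ = Γ_K`
  (`PadicInt.appr`: `ℤ_p = ℕ + p^eℤ_p`).

HONEST FRAMING: for `M = E[p]`, `Λ₀ = Gal(ℚ̄/ℚ(E[p]))` this is the first half of the cell's H²-free
«door L6 ⟹ (A)» argument; nothing about any curve is concluded here.

## References

* J. Coates, R. Sujatha, Math. Ann. 331 (2005), §3 Thm. 3.4 (proof) and Lemma 3.8. [CoatesSujatha2005]
* J. Coates, *Fragments of the GL₂ Iwasawa theory of elliptic curves without complex multiplication*,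
  LNM 1716 (1999), §2 Prop. 2.1 (`X = 0 ⟺ X/I(G)X = 0` for pro-`p` `G`; dual form used here).
  [CoatesLNM1716]
* L. C. Washington, *Introduction to Cyclotomic Fields* (1997), §13.2 (the action of `T = γ - 1`).
  [Washington1997]
-/

noncomputable section

open scoped Classical Pointwise

universe u

namespace Literature.NumberTheory.EllipticCurves.FineSelmerResidualCharacter

open NumberField IsDedekindDomain Field
open Literature.NumberTheory.EllipticCurves Literature.NumberTheory.EllipticCurves.GreenbergSelmer
  Literature.NumberTheory.GaloisRepresentations
  Literature.NumberTheory.NumberFields.EquivariantUnramifiedDescent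

/-! ## §1 Nilpotency of `γ - 1` on `p`-torsion -/

section Nilpotent

variable {V : Type*} [AddCommGroup V] {p : ℕ} [hp : Fact p.Prime]

/-- **`(A - 1)^{p^k} v = 0` when `A^{p^k} v = v` and `pV = 0`** (`(A-1)^{p^k} = A^{p^k} - 1` in the
endomorphism ring, which has characteristic `p` as soon as `V ≠ 0`).  This is the nilpotency of
`T = γ - 1` on a finite layer of a `p`-torsion Iwasawa module.
[cite: Washington1997, §13.2 (the action of `T = γ - 1`; `ω_n = (1+T)^{p^n} - 1`)] -/
theorem pow_sub_one_apply_eq_zero (hpV : ∀ v : V, p • v = 0) (A : Module.End ℤ V) (k : ℕ) (v : V)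
    (hv : (A ^ (p ^ k)) v = v) : ((A - 1) ^ (p ^ k)) v = 0 := by
  by_cases hv0 : v = 0
  · rw [hv0, map_zero]
  -- `End V` has characteristic `p` (`v ≠ 0` has order `p`)
  have hord : addOrderOf v = p := addOrderOf_eq_prime (hpV v) hv0
  haveI : CharP (Module.End ℤ V) p := ⟨fun x => by
    constructor
    · intro hx
      have h := LinearMap.congr_fun hx v
      rw [Module.End.natCast_apply, LinearMap.zero_apply] at h
      rw [← hord]
      exact addOrderOf_dvd_of_nsmul_eq_zero h
    · rintro ⟨d, rfl⟩
      apply LinearMap.ext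
      intro w
      rw [Module.End.natCast_apply, LinearMap.zero_apply, mul_comm, mul_nsmul, hpV]⟩
  have h := sub_pow_char_pow_of_commute (R := Module.End ℤ V) p k (Commute.one_right A)
  rw [h, one_pow, LinearMap.sub_apply, hv, Module.End.one_apply, sub_self]

end Nilpotent

/-! ## §2 The invariant shadow -/

section Fixed

variable {K : Type u} [Field K] [NumberField K] {p : ℕ} [Fact p.Prime] (κ : ZpExtension K p)
  {M : Type u} [AddCommGroup M] [DistribMulAction (absoluteGaloisGroup K) M]
  [TopologicalSpace M] [DiscreteTopology M]
  (Λ₀ : Subgroup (absoluteGaloisGroup K))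

omit [NumberField K] in
/-- **For an open normal `N ⊴ Γ_K`: `p^e ℤ_p ⊆ κ(N)` for some `e`** (an open subgroup of `Γ_K/ker κ ≅ ℤ_p`
has `p`-power index; `exists_level_totallyRamified` with `I = ⊤`). [cite: Washington1997, §13.1 Lemma 13.3] -/
theorem exists_pow_dvd_imp_mem_image (N : Subgroup (absoluteGaloisGroup K)) [N.Normal]
    (hN : IsOpen (N : Set (absoluteGaloisGroup K))) :
    ∃ e : ℕ, ∀ t : ℤ_[p], (p : ℤ_[p]) ^ e ∣ t → ∃ y ∈ N, (κ y).toAdd = t := by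
  haveI := absoluteGaloisGroup_compactSpace K
  haveI : N.FiniteIndex := by
    haveI := Subgroup.quotient_finite_of_isOpen N hN
    exact Subgroup.finiteIndex_of_finite_quotient
  obtain ⟨e, he⟩ := exists_level_totallyRamified κ.toContinuousMonoidHom.toMonoidHom N
    (I := fun _ : Unit => (⊤ : Subgroup (absoluteGaloisGroup K))) (pAdic := fun _ => True) ()
    (fun _ _ => ⟨1, fun x => by simp⟩) (fun t => by
      obtain ⟨y, hy⟩ := κ.surjective (Multiplicative.ofAdd t)
      exact ⟨y, Subgroup.mem_top y, by rw [← toAdd_ofAdd t, ← hy]; rfl⟩)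
  refine ⟨e, fun t ht => ?_⟩
  obtain ⟨y, -, hyN, hyt⟩ := he e le_rfl () trivial t ht
  exact ⟨y, hyN, hyt⟩

/-- **A non-zero `Γ_K`-INVARIANT shadow exists when `Sel₀(K_∞, M)` is infinite** (`M` finite with
`pM = 0`, `Λ₀ ⊴ Γ_K` open acting trivially on `M`).  See the module docstring for the proof
(pro-`p` fixed point: open stabiliser of `p`-power index, nilpotency of `γ - 1`, `ℤ_p = ℕ + p^eℤ_p`).
[cite: CoatesLNM1716, §2 Prop. 2.1 (pro-`p` groups: `X = 0 ⟺ X_G = 0`, dual form)]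
[cite: CoatesSujatha2005, §3 proof of Thm. 3.4] -/
theorem exists_invariant_shadow [Finite M] [Λ₀.Normal]
    (hΛ₀ : IsOpen (Λ₀ : Set (absoluteGaloisGroup K))) (hpM : ∀ m : M, p • m = 0)
    (htriv : ∀ σ ∈ Λ₀, ∀ m : M, σ • m = m)
    (hinf : (fineSelmerInfty M κ : Set (subgroupH1 κ.kerSubgroup M)).Infinite) :
    ∃ (f : absoluteGaloisGroup K → M) (z : contOneCocycles (discreteTopRep κ.kerSubgroup M)),
      oneCocycleClass _ z ∈ fineSelmerInfty M κ ∧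
      (∀ τ : κ.kerSubgroup, (τ : absoluteGaloisGroup K) ∈ Λ₀ → f τ = z.1 τ) ∧
      (∀ τ, τ ∉ Λ₀ ⊓ κ.kerSubgroup → f τ = 0) ∧ f ≠ 0 ∧
      ∀ g : absoluteGaloisGroup K, (fun τ => g • f (g⁻¹ * τ * g)) = f := by
  haveI := absoluteGaloisGroup_compactSpace K
  haveI : Λ₀.FiniteIndex := by
    haveI := Subgroup.quotient_finite_of_isOpen Λ₀ hΛ₀
    exact Subgroup.finiteIndex_of_finite_quotient
  -- the twisted conjugation action on functions
  let star : absoluteGaloisGroup K → (absoluteGaloisGroup K → M) → (absoluteGaloisGroup K → M) :=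
    fun g f τ => g • f (g⁻¹ * τ * g)
  have hstar_mul : ∀ (g₁ g₂ : absoluteGaloisGroup K) (f : absoluteGaloisGroup K → M),
      star (g₁ * g₂) f = star g₁ (star g₂ f) := by
    intro g₁ g₂ f
    funext τ
    have e : (g₁ * g₂)⁻¹ * τ * (g₁ * g₂) = g₂⁻¹ * (g₁⁻¹ * τ * g₁) * g₂ := by group
    change (g₁ * g₂) • f ((g₁ * g₂)⁻¹ * τ * (g₁ * g₂)) = g₁ • g₂ • f (g₂⁻¹ * (g₁⁻¹ * τ * g₁) * g₂)
    rw [e, mul_smul]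
  -- a non-zero shadow `f₀` and a topological generator `γ`
  obtain ⟨f₀, z₀, hz₀S, hfz₀, hf₀, hne⟩ := exists_shadow_ne_zero κ Λ₀ hinf
  obtain ⟨γ, hγ⟩ := κ.surjective (Multiplicative.ofAdd 1)
  rw [ZpExtension.coe_toContinuousMonoidHom] at hγ
  have hκγpow : ∀ n : ℕ, (κ (γ ^ n)).toAdd = n := by
    intro n
    rw [map_pow, toAdd_pow, hγ, toAdd_ofAdd, nsmul_eq_mul, mul_one]
  -- the operator `A = γ ⋆ ·` as a `ℤ`-linear endomorphism
  let A₀ : (absoluteGaloisGroup K → M) →+ (absoluteGaloisGroup K → M) :=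
    { toFun := star γ
      map_zero' := by funext τ; simp [star]
      map_add' := fun f f' => by funext τ; simp [star, smul_add] }
  let A : Module.End ℤ (absoluteGaloisGroup K → M) := A₀.toIntLinearMap
  have hA : ∀ f, A f = star γ f := fun f => rfl
  have hApow : ∀ (n : ℕ) (f : absoluteGaloisGroup K → M), (A ^ n) f = star (γ ^ n) f := by
    intro n f
    induction n with
    | zero =>
      rw [pow_zero, Module.End.one_apply, pow_zero]
      funext τ; simp [star]
    | succ n ih => rw [pow_succ', Module.End.mul_apply, ih, hA, ← hstar_mul, ← pow_succ']
  have hAsub : ∀ f, (A - 1) f = star γ f + -f := fun f => by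
    rw [LinearMap.sub_apply, Module.End.one_apply, hA, sub_eq_add_neg]
  -- shadows are preserved by `A - 1`
  have hstep : ∀ f : absoluteGaloisGroup K → M,
      (∃ z : contOneCocycles (discreteTopRep κ.kerSubgroup M), oneCocycleClass _ z ∈ fineSelmerInfty M κ ∧
        (∀ τ : κ.kerSubgroup, (τ : absoluteGaloisGroup K) ∈ Λ₀ → f τ = z.1 τ) ∧
        ∀ τ, τ ∉ Λ₀ ⊓ κ.kerSubgroup → f τ = 0) →
      ∃ z : contOneCocycles (discreteTopRep κ.kerSubgroup M), oneCocycleClass _ z ∈ fineSelmerInfty M κ ∧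
        (∀ τ : κ.kerSubgroup, (τ : absoluteGaloisGroup K) ∈ Λ₀ → (A - 1) f τ = z.1 τ) ∧
        ∀ τ, τ ∉ Λ₀ ⊓ κ.kerSubgroup → (A - 1) f τ = 0 := by
    rintro f ⟨z, hzS, hfz, hf⟩
    obtain ⟨zg, hzg, hfzg, hfg⟩ := shadow_conj κ Λ₀ γ f z hfz hf
    obtain ⟨hfn, hfn', hzn⟩ := shadow_neg κ Λ₀ f z hfz hf
    obtain ⟨hfa, hfa', hza⟩ := shadow_add κ Λ₀ _ _ zg (-z) hfzg hfn hfg hfn'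
    refine ⟨zg + -z, ?_, fun τ hτ => ?_, fun τ hτ => ?_⟩
    · rw [hza, hzn, hzg]
      exact (fineSelmerInfty M κ).add_mem (conjH1_mem_fineSelmerInfty M κ γ hzS)
        ((fineSelmerInfty M κ).neg_mem hzS)
    · rw [hAsub]; exact hfa τ hτ
    · rw [hAsub]; exact hfa' τ hτ
  have hiter : ∀ n : ℕ, ∃ z : contOneCocycles (discreteTopRep κ.kerSubgroup M),
      oneCocycleClass _ z ∈ fineSelmerInfty M κ ∧
      (∀ τ : κ.kerSubgroup, (τ : absoluteGaloisGroup K) ∈ Λ₀ → ((A - 1) ^ n) f₀ τ = z.1 τ) ∧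
      ∀ τ, τ ∉ Λ₀ ⊓ κ.kerSubgroup → ((A - 1) ^ n) f₀ τ = 0 := by
    intro n
    induction n with
    | zero =>
      refine ⟨z₀, hz₀S, fun τ hτ => ?_, fun τ hτ => ?_⟩
      · rw [pow_zero, Module.End.one_apply]; exact hfz₀ τ hτ
      · rw [pow_zero, Module.End.one_apply]; exact hf₀ τ hτ
    | succ n ih =>
      rw [pow_succ', Module.End.mul_apply]
      exact hstep _ ih
  -- stabilisers: `ker κ` (inner action) and an open normal `N₀`; hence `γ^{p^e}` fixes `f₀`
  have hker : ∀ (f : absoluteGaloisGroup K → M) (z : contOneCocycles (discreteTopRep κ.kerSubgroup M)),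
      (∀ τ : κ.kerSubgroup, (τ : absoluteGaloisGroup K) ∈ Λ₀ → f τ = z.1 τ) →
      (∀ τ, τ ∉ Λ₀ ⊓ κ.kerSubgroup → f τ = 0) →
      ∀ h ∈ κ.kerSubgroup, star h f = f :=
    fun f z hfz hf h hh => conj_eq_self_of_mem_ker κ Λ₀ htriv hh f z hfz hf
  obtain ⟨N₀, hN₀n, hN₀o, -, hN₀⟩ := exists_openNormal_conj_eq_self κ Λ₀ hΛ₀ htriv f₀ z₀ hfz₀ hf₀
  haveI := hN₀n
  obtain ⟨e, he⟩ := exists_pow_dvd_imp_mem_image κ N₀ hN₀o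
  have hfix : (A ^ (p ^ e)) f₀ = f₀ := by
    obtain ⟨y, hyN, hyt⟩ := he ((p : ℤ_[p]) ^ e) dvd_rfl
    have hh : y⁻¹ * γ ^ (p ^ e) ∈ κ.kerSubgroup := by
      rw [ZpExtension.mem_kerSubgroup, map_mul, map_inv, ← ofAdd_toAdd (κ y), hyt,
        ← ofAdd_toAdd (κ (γ ^ (p ^ e))), hκγpow, ← ofAdd_neg, ← ofAdd_add]
      push_cast
      rw [neg_add_cancel, ofAdd_zero]
    have e1 : γ ^ (p ^ e) = y * (y⁻¹ * γ ^ (p ^ e)) := by group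
    rw [hApow, e1, hstar_mul, hker f₀ z₀ hfz₀ hf₀ _ hh]
    exact hN₀ y hyN
  -- nilpotency: `(A - 1)^{p^e} f₀ = 0`; the last non-zero iterate `f` is `γ`-fixed
  have hpF : ∀ f : absoluteGaloisGroup K → M, p • f = 0 := fun f => by
    funext τ; simp [hpM]
  have hex : ∃ n : ℕ, ((A - 1) ^ n) f₀ = 0 := ⟨p ^ e, pow_sub_one_apply_eq_zero hpF A e f₀ hfix⟩
  obtain ⟨n₁, hn₁spec, hn₁min⟩ : ∃ n₁, ((A - 1) ^ n₁) f₀ = 0 ∧ ∀ m < n₁, ((A - 1) ^ m) f₀ ≠ 0 :=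
    ⟨Nat.find hex, Nat.find_spec hex, fun m hm => Nat.find_min hex hm⟩
  have hn₁pos : n₁ ≠ 0 := by
    intro h0
    rw [h0, pow_zero, Module.End.one_apply] at hn₁spec
    exact hne hn₁spec
  obtain ⟨j, rfl⟩ := Nat.exists_eq_succ_of_ne_zero hn₁pos
  set f := ((A - 1) ^ j) f₀ with hfdef
  have hfne : f ≠ 0 := hn₁min j (Nat.lt_succ_self j)
  have hγf : A f = f := by
    have h1 : (A - 1) f = 0 := by
      rw [hfdef, ← Module.End.mul_apply, ← pow_succ']
      exact hn₁spec
    rwa [LinearMap.sub_apply, Module.End.one_apply, sub_eq_zero] at h1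
  have hγnf : ∀ n : ℕ, star (γ ^ n) f = f := by
    intro n
    rw [← hApow]
    induction n with
    | zero => rw [pow_zero, Module.End.one_apply]
    | succ n ih => rw [pow_succ, Module.End.mul_apply, hγf, ih]
  obtain ⟨z, hzS, hfz, hf⟩ := hiter j
  refine ⟨f, z, hzS, hfz, hf, hfne, fun g => ?_⟩
  -- `g = y · h · γ^a` with `y ∈ N` (stabiliser of `f`), `h ∈ ker κ`, `a ∈ ℕ`
  obtain ⟨N, hNn, hNo, -, hN⟩ := exists_openNormal_conj_eq_self κ Λ₀ hΛ₀ htriv f z hfz hf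
  haveI := hNn
  obtain ⟨e', he'⟩ := exists_pow_dvd_imp_mem_image κ N hNo
  set x : ℤ_[p] := (κ g).toAdd with hx
  have hκg : κ g = Multiplicative.ofAdd x := by rw [hx, ofAdd_toAdd]
  have happr := PadicInt.appr_spec e' x
  rw [Ideal.mem_span_singleton] at happr
  obtain ⟨y, hyN, hyt⟩ := he' _ happr
  set a : ℕ := x.appr e' with ha
  have hh : y⁻¹ * g * (γ ^ a)⁻¹ ∈ κ.kerSubgroup := by
    rw [ZpExtension.mem_kerSubgroup, map_mul, map_mul, map_inv, map_inv, ← ofAdd_toAdd (κ y), hyt,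
      ← ofAdd_toAdd (κ (γ ^ a)), hκγpow, hκg, ← ofAdd_neg, ← ofAdd_neg, ← ofAdd_add, ← ofAdd_add]
    convert ofAdd_zero using 2
    ring
  have eg : g = y * (y⁻¹ * g * (γ ^ a)⁻¹) * γ ^ a := by group
  change star g f = f
  rw [eg, hstar_mul, hstar_mul, hγnf a, hker f z hfz hf _ hh]
  exact hN y hyN

end Fixed

end Literature.NumberTheory.EllipticCurves.FineSelmerResidualCharacter

end
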